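import Literature.NumberTheory.DiophantineGeometry.GarciaStichtenothBadPlaces
import Literature.NumberTheory.DiophantineGeometry.FunctionFieldGenusRatPlacesProofs
import HarnessLib

/-!
# The Garcia–Stichtenoth tower: the places of every level (Stichtenoth Lemmas 7.4.3, 7.4.5–7.4.6)

Topic: `Literature/NumberTheory/DiophantineGeometry` (sub-namespace `GSTower`). Assembly of
`GarciaStichtenothPlaces` / `GarciaStichtenothBadPlaces` by induction along the tower, starting from
the classification of the places of `K(x₀)` (`RatFuncPlaces`): for every level `G_N = level K q N`
(`K` finite of characteristic `p`, `q = pⁿ`, `𝔽_q ⊆ K`) and every place `Q` of `G_N`,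

* `x₀` has a pole at `Q` iff `Q = P_∞^{(N)}` (`Level.eq_Pinf_of_ord_neg`);
* if `x₀(Q) ∉ 𝔽_q` then `Q` has a `GenericProfile` (unramified over `K(x₀)`; Lemma 7.4.5);
* if `x₀(Q) = β ∈ 𝔽_q` then `Q` has a `BadProfile Q β t α` (Lemma 7.4.6 / [GS96, §3]);

(`GSTower.profile_level`), and every place falls under one of these cases
(`GSTower.Level.trichotomy`). This is the complete ramification picture of `G_N/K(x₀)` needed for the
genus computation.

## References

* H. Stichtenoth, *Algebraic Function Fields and Codes*, 2nd ed., GTM 254 (2009): §1.2 (places of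
  `K(x)`), Lemmas 7.4.3–7.4.6. [Stichtenoth2009]
-/

noncomputable section

open scoped Classical Polynomial IntermediateField
open Polynomial IsDedekindDomain

namespace Literature.NumberTheory.DiophantineGeometry

open AlgFunctionField

namespace GSTower

variable (K : Type) [Field K] (q : ℕ) [hq : Fact (2 ≤ q)]

/-! ### The bottom level `K(x₀)` -/

section Base

/-- A finite place of `K(X)` at which `X(Q) ∉ 𝔽_q`... in fact ANY finite place of `K(X)` is unramified
over `K(X)` itself: it is `P_{g(x)}` for a monic irreducible `g`, `g(X)` is a local parameter and, `K`
being perfect, `g'(X)` is a unit (Stichtenoth Prop. 1.2.1, Thm. 1.2.2).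
[cite: Stichtenoth2009, Prop. 1.2.1 and Thm. 1.2.2] -/
theorem exists_chart_ratFunc [PerfectField K] (Q : PlaceOver K (RatFunc K))
    (hX : (RatFunc.X : RatFunc K) ∈ Q.toValuationSubring) :
    ∃ f : K[X], Q.ord (aeval (RatFunc.X : RatFunc K) f) = 1 ∧
      aeval (RatFunc.X : RatFunc K) (derivative f) ≠ 0 ∧
      Q.ord (aeval (RatFunc.X : RatFunc K) (derivative f)) = 0 := by
  rcases eq_ratFuncInftyPlace_or_exists_eq_ofPrime Q with rfl | ⟨𝔭, rfl⟩
  · exfalso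
    have h := (ratFuncInftyPlace K).ord_nonneg_of_mem hX
    rw [ord_ratFuncInftyPlace_X] at h
    exact absurd h (by norm_num)
  · set g := Submodule.IsPrincipal.generator 𝔭.asIdeal with hg
    have hspan : 𝔭.asIdeal = Ideal.span {g} := (Ideal.span_singleton_generator 𝔭.asIdeal).symm
    have hg0 : g ≠ 0 := by
      intro h0; apply 𝔭.ne_bot; rw [hspan, h0, Ideal.span_singleton_eq_bot]
    have hgprime : Prime g := (Ideal.span_singleton_prime hg0).1 (hspan ▸ 𝔭.isPrime)
    have hgsep : g.Separable := PerfectField.separable_of_irreducible hgprime.irreducible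
    -- orders at `P_𝔭` from `𝔭`-adic valuations
    have hord : ∀ (r : K[X]) (m : ℤ), r ≠ 0 → 𝔭.intValuation r = WithZero.exp (-m) →
        (PlaceOver.ofPrime K (RatFunc K) 𝔭).ord (aeval (RatFunc.X : RatFunc K) r) = m := by
      intro r m hr0 hv
      have hz : aeval (RatFunc.X : RatFunc K) r = algebraMap K[X] (RatFunc K) r := by
        rw [← RatFunc.algebraMap_X, aeval_algebraMap_apply, aeval_X_left_apply]
      have hz0 : aeval (RatFunc.X : RatFunc K) r ≠ 0 := by
        rw [hz]; exact (map_ne_zero_iff _ (IsFractionRing.injective K[X] (RatFunc K))).2 hr0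
      have hvz : 𝔭.valuation (RatFunc K) (aeval (RatFunc.X : RatFunc K) r) = WithZero.exp (-m) := by
        rw [hz, HeightOneSpectrum.valuation_of_algebraMap, hv]
      apply le_antisymm
      · by_contra h
        push Not at h
        have h1 : m + 1 ≤ (PlaceOver.ofPrime K (RatFunc K) 𝔭).ord (aeval (RatFunc.X : RatFunc K) r) := by omega
        rw [← (PlaceOver.ofPrime K (RatFunc K) 𝔭).valuation_le_zpow_iff_le_ord hz0,
          show (m + 1 : ℤ) = -(-(m + 1)) by ring, PlaceOver.valuation_ofPrime_le_iff, hvz,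
          WithZero.exp_le_exp] at h1
        omega
      · rw [← (PlaceOver.ofPrime K (RatFunc K) 𝔭).valuation_le_zpow_iff_le_ord hz0,
          show (m : ℤ) = -(-m) by ring, PlaceOver.valuation_ofPrime_le_iff, hvz]
    have hg'mem : derivative g ∉ 𝔭.asIdeal := by
      rw [hspan, Ideal.mem_span_singleton]
      intro hdvd
      obtain ⟨a, b, hab⟩ := hgsep
      exact hgprime.not_unit (isUnit_of_dvd_one (hab ▸ dvd_add (dvd_mul_left g a) (hdvd.mul_left b)))
    have hg'0 : derivative g ≠ 0 := by
      intro h0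
      rw [Separable, h0, isCoprime_zero_right] at hgsep
      exact hgprime.not_unit hgsep
    refine ⟨g, hord g 1 hg0 (𝔭.intValuation_singleton hg0 hspan), ?_, hord _ 0 hg'0 ?_⟩
    · rw [show aeval (RatFunc.X : RatFunc K) (derivative g) = algebraMap K[X] (RatFunc K) (derivative g) by
        rw [← RatFunc.algebraMap_X, aeval_algebraMap_apply, aeval_X_left_apply]]
      exact (map_ne_zero_iff _ (IsFractionRing.injective K[X] (RatFunc K))).2 hg'0
    · rw [neg_zero, WithZero.exp_zero]
      exact HeightOneSpectrum.intValuation_eq_one_iff.2 hg'mem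

/-- `v_Q(X - β) = 1` at every zero `Q` of `X - β` in `K(X)` (`X - β` has degree `1`).
[cite: Stichtenoth2009, Prop. 1.2.1] -/
theorem ord_X_sub_algebraMap_eq_one (Q : PlaceOver K (RatFunc K)) (β : K)
    (h : 0 < Q.ord ((RatFunc.X : RatFunc K) - algebraMap K (RatFunc K) β)) :
    Q.ord ((RatFunc.X : RatFunc K) - algebraMap K (RatFunc K) β) = 1 := by
  set z : RatFunc K := RatFunc.X - algebraMap K (RatFunc K) β with hz
  have htr : Transcendental K z := by
    intro halg
    have hX : IsAlgebraic K (RatFunc.X : RatFunc K) := by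
      have := halg.add (isAlgebraic_algebraMap (R := K) (A := RatFunc K) β)
      rwa [hz, sub_add_cancel] at this
    have h0 := (ratFuncInftyPlace K).ord_eq_zero_of_isAlgebraic RatFunc.X_ne_zero hX
    rw [ord_ratFuncInftyPlace_X] at h0
    norm_num at h0
  have htop : K⟮z⟯ = ⊤ := by
    rw [eq_top_iff, ← RatFunc.adjoin_X, IntermediateField.adjoin_simple_le_iff]
    have := add_mem (IntermediateField.mem_adjoin_simple_self K z)
      (IntermediateField.algebraMap_mem K⟮z⟯ β)
    rwa [hz, sub_add_cancel] at this
  have hsum := sum_ord_mul_degree_le_finrank_int htr {Q} (fun P hP => by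
    rw [Finset.mem_singleton.1 hP]; exact h)
  rw [Finset.sum_singleton, htop, IntermediateField.finrank_top] at hsum
  have hdeg : (1 : ℤ) ≤ Q.degree := by exact_mod_cast PlaceOver.degree_pos_holds Q
  push_cast at hsum
  nlinarith

omit hq in
/-- **The bottom level in general position**: a place of `K(x₀)` with `x₀(Q) ∉ 𝔽_q ∪ {∞}` has a
generic profile. [cite: Stichtenoth2009, Prop. 1.2.1] -/
theorem genericProfile_base [PerfectField K] (Q : PlaceOver K (base K q).carrier)
    (hX : (base K q).x 0 ∈ Q.toValuationSubring)
    (hv : Q.valuation ((base K q).x 0 ^ q - (base K q).x 0) = 1) : (base K q).GenericProfile Q :=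
  ⟨fun _ _ => hX, fun _ _ => hv, exists_chart_ratFunc K Q hX⟩

omit hq in
/-- **The bottom level above `x₀ = β`**, `β ∈ 𝔽_q`: profile `t = 0, α = β` if `β ≠ 0` and
`t = 1` if `β = 0` (`v_Q(x₀ - β) = 1`). [cite: Stichtenoth2009, Prop. 1.2.1] -/
theorem exists_badProfile_base (Q : PlaceOver K (base K q).carrier) {β : K} (hβ : β ^ q = β)
    (h : 0 < Q.ord ((base K q).x 0 - algebraMap K (base K q).carrier β)) :
    ∃ t α, (base K q).BadProfile Q β t α := by
  have h1 := ord_X_sub_algebraMap_eq_one K Q β h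
  have hN : (base K q).N = 0 := rfl
  by_cases hβ0 : β = 0
  · subst hβ0
    refine ⟨1, 1, ⟨by rw [hN], fun h => absurd rfl h, fun _ => le_rfl, one_pow _, one_ne_zero,
      fun i hi _ => ?_, fun ht => by rw [hN] at ht; omega, fun i h1 h2 h3 => by rw [hN] at h3; omega,
      fun i h1 h2 h3 => by rw [hN] at h3; omega, fun i h1 h2 => by rw [hN] at h2; omega⟩⟩
    have hi0 : i = 0 := by omega
    subst hi0
    rw [map_zero, sub_zero] at h1
    rw [hN]; simpa using h1
  · refine ⟨0, β, ⟨Nat.zero_le _, fun _ => ⟨rfl, rfl⟩, fun h0 => absurd h0 hβ0, hβ, hβ0,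
      fun i hi _ => absurd hi (Nat.not_lt_zero i), fun _ => ?_, fun i h1 h2 h3 => by omega,
      fun i h1 h2 h3 => by omega, fun i h1 h2 => by rw [hN] at h2; omega⟩⟩
    rw [hN]; simpa using h1

end Base

/-! ### All levels -/

section All

variable {K q}
variable {p n : ℕ} [Fact p.Prime] [CharP K p]

/-- **The places of the levels of the Garcia–Stichtenoth tower** (Lemmas 7.4.5–7.4.6 / [GS96, §3]):
at every level, a place with `x₀(Q) ∉ 𝔽_q ∪ {∞}` has a generic profile and a place with
`x₀(Q) = β ∈ 𝔽_q` has a bad profile. [cite: Stichtenoth2009, Lemma 7.4.5 and Lemma 7.4.6] -/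
theorem profile_level [Finite K] (hqp : q = p ^ n)
    (hFq : ∀ (L' : Type) [Field L'] [Algebra K L'] (c : L'), c ^ q = c → ∃ γ : K, algebraMap K L' γ = c)
    (N : ℕ) :
    (∀ Q : PlaceOver K (level K q N).carrier, (level K q N).x 0 ∈ Q.toValuationSubring →
        Q.valuation ((level K q N).x 0 ^ q - (level K q N).x 0) = 1 → (level K q N).GenericProfile Q) ∧
    (∀ (Q : PlaceOver K (level K q N).carrier) (β : K), β ^ q = β →
        0 < Q.ord ((level K q N).x 0 - algebraMap K (level K q N).carrier β) →
        ∃ t α, (level K q N).BadProfile Q β t α) := by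
  haveI : PerfectField K := PerfectField.ofFinite
  induction N with
  | zero => exact ⟨fun Q hX hv => genericProfile_base K q Q hX hv,
      fun Q β hβ h => exists_badProfile_base K q Q hβ h⟩
  | succ N ih =>
    obtain ⟨ihG, ihB⟩ := ih
    rw [level_succ]
    refine ⟨fun Q' hX hv => ?_, fun Q' β hβ h => ?_⟩
    · rw [(level K q N).next_x_of_le (Nat.zero_le _)] at hX hv
      rw [← map_pow, ← map_sub] at hv
      exact (level K q N).genericProfile_next hqp (ihG _
        ((Q'.mem_restrict_iff (K := K) (F := (level K q N).carrier) _).2 hX)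
        ((level K q N).valuation_eq_one_of_algebraMap hv))
    · rw [(level K q N).next_x_of_le (Nat.zero_le _), (level K q N).algebraMap_next, ← map_sub,
        (level K q N).ord_algebraMap_pos_iff] at h
      obtain ⟨t, α, hbad⟩ := ihB _ β hβ h
      exact (level K q N).exists_badProfile_next hqp hFq hbad

omit [Fact p.Prime] [CharP K p] in
/-- **Trichotomy**: at every place of a level, either `x₀` has a pole, or `x₀` is finite with residue
outside `𝔽_q`, or `x₀ ≡ β` for some `β ∈ 𝔽_q` (given `𝔽_q ⊆ K`). [cite: Stichtenoth2009, Lemma 7.4.5] -/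
theorem Level.trichotomy (L : Level K q)
    (hFq : ∀ (L' : Type) [Field L'] [Algebra K L'] (c : L'), c ^ q = c → ∃ γ : K, algebraMap K L' γ = c)
    (Q : PlaceOver K L.carrier) :
    Q.ord (L.x 0) < 0 ∨ (L.x 0 ∈ Q.toValuationSubring ∧ Q.valuation (L.x 0 ^ q - L.x 0) = 1) ∨
      ∃ β : K, β ^ q = β ∧ 0 < Q.ord (L.x 0 - algebraMap K L.carrier β) := by
  have hx0 : L.x 0 ≠ 0 := L.x_ne_zero (Nat.zero_le _)
  by_cases hO : L.x 0 ∈ Q.toValuationSubring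
  · right
    have hle : Q.valuation (L.x 0 ^ q - L.x 0) ≤ 1 :=
      (Q.toValuationSubring.valuation_le_one_iff _).2 (sub_mem (pow_mem hO _) hO)
    rcases hle.lt_or_eq with hlt | heq
    · right
      have hres : (IsLocalRing.residue Q.toValuationSubring ⟨L.x 0, hO⟩) ^ q =
          IsLocalRing.residue Q.toValuationSubring ⟨L.x 0, hO⟩ := by
        rw [← sub_eq_zero, ← map_pow, ← map_sub, IsLocalRing.residue_eq_zero_iff,
          ValuationSubring.valuation_lt_one_iff]
        exact hlt
      obtain ⟨β, hβ⟩ := hFq Q.residueField _ hres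
      refine ⟨β, (algebraMap K Q.residueField).injective (by rw [map_pow, hβ, hres]), ?_⟩
      have hne : L.x 0 - algebraMap K L.carrier β ≠ 0 := by
        have := L.aeval_x_ne_zero (Nat.zero_le _) (X_sub_C_ne_zero β)
        rwa [map_sub, aeval_X, aeval_C] at this
      rw [← PlaceOver.valuation_lt_one_iff_ord_pos _ hne]
      have : IsLocalRing.residue Q.toValuationSubring ⟨L.x 0, hO⟩ =
          IsLocalRing.residue Q.toValuationSubring ⟨algebraMap K L.carrier β, Q.algebraMap_mem β⟩ := by
        rw [← hβ]; rfl
      exact (PlaceOver.residue_eq_residue_iff _ _ _).1 this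
    · left; exact ⟨hO, heq⟩
  · left
    rwa [Q.mem_toValuationSubring_iff_ord_nonneg hx0, not_le] at hO

end All

end GSTower

end Literature.NumberTheory.DiophantineGeometry
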